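/-
  Summits/AtomisticToContinuum/Crystallization/Theorems/OverbindingBudgetAffineFarCensusChargeA.lean

  residual stmt-AtomisticToContinuum-31280 · slot Z `FarAggregatePricing 12 (1/25) (1/2000) (1/(2·10⁷))` · the L-slot: THE CENSUS CHARGE, PART A
  (packing beyond a radius, ★ the far-field census charge theorem, and the TYPED pieces Z3b⁗' / Z3⁗' with the scale-census allowance; decomp-a2c lens-4
  «minimal counterexample / extremal reduction», generations 54–55).  Part B (`…FarCensusCharge`) carries the glue, ★ Z3b⁗' from the near field, the seam
  and the slot records.  Imports ONLY the tree file `…OverbindingBudgetAffineFarRechartShelter`.  0 sorry · 0 axiom · no instance · no notation · no option.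
-/
import Summits.AtomisticToContinuum.Crystallization.Theorems.OverbindingBudgetAffineFarRechartShelter
import Summits.AtomisticToContinuum.Crystallization.Theorems.OverbindingBudgetAffineFarQuarticCount

/-! # The far field DISCHARGED, part A: normal scale, window lift, packing beyond a radius, ★ the far-field census charge (all PROVED), and the typed
# pieces Z3b⁗' `RechartedInflowWallLawSb` / Z3⁗' `RechartedTailTransferInfSb` · `RechartedTailTransferSelSb` (each WEAKER than its tree twin, PROVED)

Seen from the SCALE CENSUS the far field of the L-slot is trivial:
* every GOOD site is either NORMAL-SCALE (`k ∈ G ∖ sb ⇒ nn_k ≥ (122/125)(49/50) = 0.95648 ≥ 19/20`, `nearestDist_lb_of_good_not_scaleBad`: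
  good ⇒ charge-free, not scale-bad ⇒ not SHORT or passes `RT (122/125) 0`) or SCALE-BAD (`k ∈ sb`, priced by the leaf Z4″ `ScaleBadFloor`);
* WINDOW LIFT (`sdiff_scaleBad_subset_goodSet_lift`): `G(δ) ∖ sb(δ) ⊆ G(19/20)` — the normal class is a good class of the ABSOLUTE window
  `[19/20, 2]`, so the tree's `δ`-packing count `card_goodSet_filter_dist_le` applies to it with `δ := 19/20`;
* PACKING BEYOND A RADIUS (`sum_invPowSix_le_of_separated`, PROVED): for a `s`-separated good class `T`, a point `p` and `ρ₀ ≥ s`,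
  `Σ_{i ∈ T, |y i − p| ≥ ρ₀} |y i − p|⁻⁶ ≤ 250/(s³ρ₀³)` (dyadic shells `ρ₀2ʲ < d ≤ ρ₀2ʲ⁺¹`, count `≤ (5ρ₀2ʲ/s)³`, weight `(ρ₀2ʲ)⁻⁶`);
* beyond the DRIFT RADIUS of a normal row (`1 ≤ C₁ε₁(d/nn_i)²`, so `d ≥ ρ₀ := (19/20)/√(C₁ε₁) ≥ 1` once `C₁ε₁ ≤ (19/20)²`) every tail term is
  `≤ d⁻⁶/12` (`neg_tailW_mul_lennardJones_le`), hence — ★ `farField_censusCharge` (PROVED, chart-free, kernel-free) — for ANY class of normal rows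
  `T ⊆ G ∖ sb` and ANY far classes `S i ⊆ G`:
      `Σ_{i ∈ T} −smoothTail (S i) y i ≤ 30·C₁ε₁·(#T + #sb)`:
  the normal columns cost `≤ (250/12)(20/19)⁵·C₁ε₁ ≤ 30C₁ε₁` PER ROW, and the scale-bad columns, after EXCHANGING THE SUMS, cost `≤ 30C₁ε₁` PER
  SCALE-BAD SITE (the rows facing one scale-bad column are themselves a `19/20`-separated class beyond `ρ₀` from it).
So the far field needs no shelter, no chart, no kernel, no count of defect-free matter and no rigidity: it is paid by `C'''ε₁·#Sh` plus an
ARBITRARILY SMALL multiple `cL·#sb` of the scale census (`ε₁ ≤ cL/(30C₁)`).  The pieces Z3b⁗' / Z3⁗' (§3) are the tree statements Z3b⁗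
`RechartedInflowWallLaw` / Z3⁗ `RechartedTailTransferInf` plus that allowance (`∀ cL > 0` right after `R`; PROVED weaker: `…Sb_of_wallLaw`,
`…InfSb_of_inf`, and the ε₁-minimiser selection `…SelSb_of_inf`); part B proves Z3b⁗' from the near field alone and closes the slot.
-/
namespace Summit.AtomisticToContinuum.Crystallization.Theorems.OverbindingBudgetAffineFarSmoothSplit

open scoped BigOperators Classical
open Literature.MathematicalPhysics.StatisticalMechanics
open Literature.Geometry.DiscreteGeometry (nearestDist nearestDist_nonneg nearestDist_le_dist le_nearestDist nearestDist_def IsChargeFree)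
open Summit.AtomisticToContinuum.Crystallization.Theorems.OverbindingBudgetBalancedCensusStatements
open Summit.AtomisticToContinuum.Crystallization.Theorems.OverbindingBudgetAffineLadder
open Summit.AtomisticToContinuum.Crystallization.Theorems.OverbindingBudgetAffineLocalisation
open Summit.AtomisticToContinuum.Crystallization.Theorems.OverbindingBudgetMisfitCensusStatements (Bad Short Long)
open Summit.AtomisticToContinuum.Crystallization.Theorems.OverbindingBudgetViolatorDensityFloor (RT)

variable {N : ℕ}

/-! ## §1  Normal scale, the window lift, and packing beyond a radius (PROVED) -/

/-- **Normal good sites have unit scale**: `k ∈ G`, `k ∉ sb` ⇒ `nn_k ≥ (122/125)(1 − 1/50) = 0.95648` — good ⇒ `(1/100)`-charge-free (`AffDeepReg` at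
`i' = k`); not `Bad ∧ (Short ∨ Long)` ⇒ not SHORT (the bound itself) or not BAD, i.e. `RT (122/125) 0` holds, whose separation clause bounds every other
distance from below. [this file] -/
theorem nearestDist_lb_of_good_not_scaleBad {ε₁ θ δ : ℝ} (hδ : 0 < δ) {y : Fin N → EuclideanSpace ℝ (Fin 3)} (hy : Function.Injective y)
    {i : Fin N} (hiG : i ∈ goodSet 12 ε₁ θ δ y) (hisb : i ∉ goodScaleBadSet 12 ε₁ θ δ y) :
    122 / 125 * (1 - 1 / 50) ≤ nearestDist y i := by
  have hG := hiG; unfold goodSet at hG; rw [Finset.mem_filter] at hG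
  obtain ⟨-, hdeep, hwin⟩ := hG
  have hex : ∃ k : Fin N, k ≠ i := by
    by_contra h; push Not at h
    haveI : IsEmpty {k : Fin N // k ≠ i} := ⟨fun k => k.2 (h k.1)⟩
    have h0 : nearestDist y i = 0 := by rw [nearestDist_def]; exact Real.iInf_of_isEmpty _
    linarith [hwin.1]
  have hnot : ¬ (Bad (122 / 125) 0 y i ∧ (Short (122 / 125) 0 y i ∨ Long (122 / 125) 0 y i)) := fun hb =>
    hisb (by unfold goodScaleBadSet; rw [Finset.mem_filter]; exact ⟨hiG, hb⟩)
  by_cases hS : Short (122 / 125) 0 y i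
  · have hcf : IsChargeFree (1 / 100 : ℝ) y i :=
      (hdeep i (by rw [dist_self]; exact mul_nonneg (by norm_num) (nearestDist_nonneg y i))).1
    have hRT : RT (122 / 125) 0 (Set.range y) (y i) := by by_contra hRT; exact hnot ⟨⟨hcf, hRT⟩, Or.inl hS⟩
    exact le_nearestDist hex fun k hk => by linarith [(hRT.2.2 (y k) ⟨k, rfl⟩ fun h => hk (hy h)).1]
  · unfold Short at hS; push Not at hS; linarith

/-- **WINDOW LIFT**: the normal class of the `δ`-window good class is a good class of the ABSOLUTE window `[19/20, 2]`:
`G(δ) ∖ sb(δ) ⊆ G(19/20)` (same affine deep registration; `nn ≥ 0.95648 ≥ 19/20`). [this file] -/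
theorem sdiff_scaleBad_subset_goodSet_lift {ε₁ θ δ : ℝ} (hδ : 0 < δ) {y : Fin N → EuclideanSpace ℝ (Fin 3)} (hy : Function.Injective y) :
    goodSet 12 ε₁ θ δ y \ goodScaleBadSet 12 ε₁ θ δ y ⊆ goodSet 12 ε₁ θ (19 / 20) y := by
  intro k hk
  obtain ⟨hkG, hksb⟩ := Finset.mem_sdiff.mp hk
  have hnn := nearestDist_lb_of_good_not_scaleBad hδ hy hkG hksb
  have hG := hkG; unfold goodSet at hG ⊢; rw [Finset.mem_filter] at hG ⊢
  exact ⟨hG.1, hG.2.1, by linarith, hG.2.2.2⟩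

/-- ★ **PACKING BEYOND A RADIUS (PROVED)**: for a good class `T` of the window `[s, 2]` (`s > 0`: its sites are `s`-separated from everything), a point `p`
and a radius `ρ₀ ≥ s`, the sites of `T` at distance `≥ ρ₀` from `p` have `Σ |y i − p|⁻⁶ ≤ 250/(s³ρ₀³)` — dyadic shells `ρ₀2ʲ < d ≤ ρ₀2ʲ⁺¹` hold
`≤ (2ρ₀2ʲ⁺¹/s + 1)³ ≤ (5ρ₀2ʲ/s)³` sites (`card_goodSet_filter_dist_le`) at weight `≤ (ρ₀2ʲ)⁻⁶`, and `Σ_j 125·2⁻³ʲ ≤ Σ_j 125·2⁻ʲ ≤ 250`. [this file] -/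
theorem sum_invPowSix_le_of_separated {ρ₁ ε₁ θ s : ℝ} (hs : 0 < s) {y : Fin N → EuclideanSpace ℝ (Fin 3)} (hy : Function.Injective y)
    (p : EuclideanSpace ℝ (Fin 3)) {ρ₀ : ℝ} (hρ₀ : s ≤ ρ₀) {T : Finset (Fin N)} (hT : T ⊆ goodSet ρ₁ ε₁ θ s y)
    (hfar : ∀ i ∈ T, ρ₀ ≤ dist (y i) p) :
    ∑ i ∈ T, ((dist (y i) p)⁻¹) ^ 6 ≤ 250 / (s ^ 3 * ρ₀ ^ 3) := by
  have hρ₀pos : 0 < ρ₀ := lt_of_lt_of_le hs hρ₀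
  -- a dyadic ceiling for the distances to `p`
  obtain ⟨J, hJ⟩ : ∃ J : ℕ, ∀ i : Fin N, dist (y i) p ≤ ρ₀ * 2 ^ (J + 1) := by
    obtain ⟨n, hn⟩ := pow_unbounded_of_one_lt ((∑ i, dist (y i) p) / ρ₀) (by norm_num : (1 : ℝ) < 2)
    refine ⟨n, fun i => ?_⟩
    have h1 : dist (y i) p ≤ ∑ i, dist (y i) p := Finset.single_le_sum (fun i _ => dist_nonneg) (Finset.mem_univ i)
    have h2 : (∑ i, dist (y i) p) < ρ₀ * 2 ^ n := by rw [div_lt_iff₀ hρ₀pos] at hn; linarith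
    have h3 : ρ₀ * 2 ^ n ≤ ρ₀ * 2 ^ (n + 1) := mul_le_mul_of_nonneg_left (pow_le_pow_right₀ (by norm_num) (Nat.le_succ n)) hρ₀pos.le
    linarith
  -- pointwise dyadic domination
  have hdom : ∀ i ∈ T, ((dist (y i) p)⁻¹) ^ 6
      ≤ ∑ j ∈ Finset.range (J + 1), ((ρ₀ * 2 ^ j)⁻¹) ^ 6 * (if dist (y i) p ≤ ρ₀ * 2 ^ (j + 1) then (1 : ℝ) else 0) :=
    fun i hi => inv_pow_six_le_dyadic hρ₀pos (hfar i hi) (hJ i)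
  -- the shell weights against the packing count
  have hterm : ∀ j ∈ Finset.range (J + 1),
      ((ρ₀ * 2 ^ j)⁻¹) ^ 6 * (2 * (ρ₀ * 2 ^ (j + 1)) / s + 1) ^ 3 ≤ 125 / (s ^ 3 * ρ₀ ^ 3) * (1 / 2 : ℝ) ^ j := by
    intro j _
    have hT1 : (1 : ℝ) ≤ 2 ^ j := one_le_pow₀ (by norm_num)
    have hT : (0 : ℝ) < 2 ^ j := by positivity
    have hq : 1 ≤ ρ₀ * 2 ^ j / s := by
      rw [le_div_iff₀ hs, one_mul]
      calc s ≤ ρ₀ := hρ₀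
        _ = ρ₀ * 1 := (mul_one ρ₀).symm
        _ ≤ ρ₀ * 2 ^ j := mul_le_mul_of_nonneg_left hT1 hρ₀pos.le
    have h1 : 2 * (ρ₀ * 2 ^ (j + 1)) / s + 1 ≤ 5 * (ρ₀ * 2 ^ j) / s := by
      have e1 : 2 * (ρ₀ * 2 ^ (j + 1)) / s = 4 * (ρ₀ * 2 ^ j / s) := by rw [pow_succ]; ring
      have e2 : 5 * (ρ₀ * 2 ^ j) / s = 5 * (ρ₀ * 2 ^ j / s) := by ring
      rw [e1, e2]; linarith
    have h2 : (2 * (ρ₀ * 2 ^ (j + 1)) / s + 1) ^ 3 ≤ (5 * (ρ₀ * 2 ^ j) / s) ^ 3 := pow_le_pow_left₀ (by positivity) h1 3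
    have h3 : (1 / 2 ^ j : ℝ) ^ 3 ≤ 1 / 2 ^ j := pow_le_of_le_one (by positivity) ((div_le_one hT).mpr hT1) (by norm_num)
    calc ((ρ₀ * 2 ^ j)⁻¹) ^ 6 * (2 * (ρ₀ * 2 ^ (j + 1)) / s + 1) ^ 3
        ≤ ((ρ₀ * 2 ^ j)⁻¹) ^ 6 * (5 * (ρ₀ * 2 ^ j) / s) ^ 3 := mul_le_mul_of_nonneg_left h2 (by positivity)
      _ = 125 / (s ^ 3 * ρ₀ ^ 3) * (1 / 2 ^ j) ^ 3 := by field_simp; ring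
      _ ≤ 125 / (s ^ 3 * ρ₀ ^ 3) * (1 / 2 ^ j) := mul_le_mul_of_nonneg_left h3 (by positivity)
      _ = 125 / (s ^ 3 * ρ₀ ^ 3) * (1 / 2 : ℝ) ^ j := by rw [one_div_pow]
  calc ∑ i ∈ T, ((dist (y i) p)⁻¹) ^ 6
      ≤ ∑ i ∈ T, ∑ j ∈ Finset.range (J + 1), ((ρ₀ * 2 ^ j)⁻¹) ^ 6 * (if dist (y i) p ≤ ρ₀ * 2 ^ (j + 1) then (1 : ℝ) else 0) :=
        Finset.sum_le_sum hdom
    _ = ∑ j ∈ Finset.range (J + 1), ((ρ₀ * 2 ^ j)⁻¹) ^ 6 * ((T.filter fun i => dist (y i) p ≤ ρ₀ * 2 ^ (j + 1)).card : ℝ) := by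
        rw [Finset.sum_comm]
        refine Finset.sum_congr rfl fun j _ => ?_
        rw [← Finset.mul_sum, Finset.sum_boole]
    _ ≤ ∑ j ∈ Finset.range (J + 1), ((ρ₀ * 2 ^ j)⁻¹) ^ 6 * (2 * (ρ₀ * 2 ^ (j + 1)) / s + 1) ^ 3 := by
        refine Finset.sum_le_sum fun j _ => mul_le_mul_of_nonneg_left ?_ (by positivity)
        have hsub : (T.filter fun i => dist (y i) p ≤ ρ₀ * 2 ^ (j + 1))
            ⊆ ((goodSet ρ₁ ε₁ θ s y).filter fun i => dist (y i) p ≤ ρ₀ * 2 ^ (j + 1)) := Finset.filter_subset_filter _ hT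
        exact le_trans (by exact_mod_cast Finset.card_le_card hsub) (card_goodSet_filter_dist_le hs hy p (by positivity))
    _ ≤ ∑ j ∈ Finset.range (J + 1), 125 / (s ^ 3 * ρ₀ ^ 3) * (1 / 2 : ℝ) ^ j := Finset.sum_le_sum hterm
    _ = 125 / (s ^ 3 * ρ₀ ^ 3) * ∑ j ∈ Finset.range (J + 1), (1 / 2 : ℝ) ^ j := by rw [Finset.mul_sum]
    _ ≤ 125 / (s ^ 3 * ρ₀ ^ 3) * 2 := mul_le_mul_of_nonneg_left (sum_geometric_two_le _) (by positivity)
    _ = 250 / (s ^ 3 * ρ₀ ^ 3) := by ring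

/-! ## §2  ★ The far-field census charge (PROVED · chart-free · kernel-free · shelter-free) -/

/-- ★ **THE FAR-FIELD CENSUS CHARGE (PROVED)**: for `C₁ > 0`, `C₁ε₁ ≤ (19/20)²`, any window floor `δ > 0`, an injective configuration, ANY class
`T ⊆ G ∖ sb` of normal rows and ANY far classes `S i ⊆ G` (`1 ≤ C₁ε₁(|y i − y k|/nn_i)²` on `S i`):
`Σ_{i ∈ T} −smoothTail (S i) y i ≤ 30·C₁ε₁·(#T + #sb)`.  Termwise `≤ d⁻⁶/12`; the far condition and `nn_i ≥ 19/20` put every column beyond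
`ρ₀ = (19/20)/√(C₁ε₁) ≥ 1`; NORMAL columns: the window lift and `sum_invPowSix_le_of_separated` around `y i` (`≤ 250/((19/20)³ρ₀³) ≤ 360·C₁ε₁` per
row); SCALE-BAD columns: exchange the sums — the rows of `T` facing one scale-bad site `k` are a lifted good class beyond `ρ₀` from `y k`
(`≤ 360·C₁ε₁` per scale-bad SITE). [this file] -/
theorem farField_censusCharge {C₁ ε₁ θ δ : ℝ} (hC₁ : 0 < C₁) (hε₁ : 0 < ε₁) (hCε : C₁ * ε₁ ≤ (19 / 20) ^ 2) (hδ : 0 < δ)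
    {y : Fin N → EuclideanSpace ℝ (Fin 3)} (hy : Function.Injective y) {T : Finset (Fin N)}
    (hT : T ⊆ goodSet 12 ε₁ θ δ y \ goodScaleBadSet 12 ε₁ θ δ y) (S : Fin N → Finset (Fin N))
    (hS : ∀ i ∈ T, S i ⊆ goodSet 12 ε₁ θ δ y)
    (hfar : ∀ i ∈ T, ∀ k ∈ S i, 1 ≤ C₁ * ε₁ * (dist (y i) (y k) / nearestDist y i) ^ 2) :
    ∑ i ∈ T, -smoothTail (S i) y i
      ≤ 30 * C₁ * ε₁ * ((T.card : ℝ) + ((goodScaleBadSet 12 ε₁ θ δ y).card : ℝ)) := by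
  set sb := goodScaleBadSet 12 ε₁ θ δ y with hsb_def
  have hCε0 : 0 < C₁ * ε₁ := mul_pos hC₁ hε₁
  have hlift : goodSet 12 ε₁ θ δ y \ sb ⊆ goodSet 12 ε₁ θ (19 / 20) y := sdiff_scaleBad_subset_goodSet_lift hδ hy
  -- the far radius ρ₀ = (19/20)/√(C₁ε₁)
  set ρ₀ : ℝ := Real.sqrt ((19 / 20) ^ 2 / (C₁ * ε₁)) with hρ₀_def
  have hρ₀0 : 0 ≤ ρ₀ := Real.sqrt_nonneg _
  have hρ₀sq : ρ₀ ^ 2 = (19 / 20) ^ 2 / (C₁ * ε₁) := Real.sq_sqrt (by positivity)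
  have hρ₀1 : 1 ≤ ρ₀ := by
    have h1 : (1 : ℝ) ^ 2 ≤ ρ₀ ^ 2 := by rw [hρ₀sq, one_pow, le_div_iff₀ hCε0]; linarith
    exact (pow_le_pow_iff_left₀ zero_le_one hρ₀0 two_ne_zero).mp h1
  have hρ₀pos : 0 < ρ₀ := lt_of_lt_of_le one_pos hρ₀1
  have hρ₀s : (19 / 20 : ℝ) ≤ ρ₀ := le_trans (by norm_num) hρ₀1
  -- the packing constant against C₁ε₁:  250/((19/20)³ρ₀³) ≤ 250/((19/20)³ρ₀²) = (250/(19/20)⁵)·C₁ε₁ ≤ 360·C₁ε₁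
  have hL : 250 / ((19 / 20 : ℝ) ^ 3 * ρ₀ ^ 3) ≤ 360 * (C₁ * ε₁) := by
    have h1 : 250 / ((19 / 20 : ℝ) ^ 3 * ρ₀ ^ 3) ≤ 250 / ((19 / 20 : ℝ) ^ 3 * ρ₀ ^ 2) := by
      refine div_le_div_of_nonneg_left (by norm_num) (by positivity) ?_
      exact mul_le_mul_of_nonneg_left (pow_le_pow_right₀ hρ₀1 (by norm_num)) (by positivity)
    have h2 : 250 / ((19 / 20 : ℝ) ^ 3 * ρ₀ ^ 2) = 250 / (19 / 20 : ℝ) ^ 5 * (C₁ * ε₁) := by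
      rw [hρ₀sq]; field_simp
    have h3 : 250 / (19 / 20 : ℝ) ^ 5 * (C₁ * ε₁) ≤ 360 * (C₁ * ε₁) := mul_le_mul_of_nonneg_right (by norm_num) hCε0.le
    linarith
  -- the far condition puts every column beyond ρ₀
  have hfarρ : ∀ i ∈ T, ∀ k ∈ S i, ρ₀ ≤ dist (y i) (y k) := by
    intro i hi k hk
    obtain ⟨hiG, hisb⟩ := Finset.mem_sdiff.mp (hT hi)
    have hnn : (19 / 20 : ℝ) ≤ nearestDist y i := le_trans (by norm_num) (nearestDist_lb_of_good_not_scaleBad hδ hy hiG hisb)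
    have hnn0 : 0 < nearestDist y i := lt_of_lt_of_le (by norm_num) hnn
    have h0 := hfar i hi k hk
    have hd0 : 0 ≤ dist (y i) (y k) := dist_nonneg
    have h1 : (dist (y i) (y k) / nearestDist y i) ^ 2 ≤ dist (y i) (y k) ^ 2 / (19 / 20) ^ 2 := by
      rw [div_pow]
      exact div_le_div_of_nonneg_left (sq_nonneg _) (by positivity) (pow_le_pow_left₀ (by norm_num) hnn 2)
    have h2 : 1 ≤ C₁ * ε₁ * (dist (y i) (y k) ^ 2 / (19 / 20) ^ 2) := le_trans h0 (mul_le_mul_of_nonneg_left h1 hCε0.le)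
    have h3 : (19 / 20 : ℝ) ^ 2 ≤ C₁ * ε₁ * dist (y i) (y k) ^ 2 := by
      rw [← mul_div_assoc, le_div_iff₀ (by positivity), one_mul] at h2
      linarith
    have h4 : ρ₀ ^ 2 ≤ dist (y i) (y k) ^ 2 := by rw [hρ₀sq, div_le_iff₀ hCε0]; linarith
    exact (pow_le_pow_iff_left₀ hρ₀0 hd0 two_ne_zero).mp h4
  -- one row: normal columns by packing around the row, scale-bad columns kept as a transferable sum
  have hrow : ∀ i ∈ T, -smoothTail (S i) y i ≤ 1 / 12 * (250 / ((19 / 20 : ℝ) ^ 3 * ρ₀ ^ 3))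
      + 1 / 12 * ∑ k ∈ sb, (if k ∈ S i then ((dist (y i) (y k))⁻¹) ^ 6 else 0) := by
    intro i hi
    have h0 : ∀ k ∈ S i, 0 < dist (y i) (y k) := fun k hk => lt_of_lt_of_le hρ₀pos (hfarρ i hi k hk)
    have h1 := neg_smoothTail_le_sum_inv_pow_six h0
    have h2 : ∑ k ∈ S i, ((dist (y i) (y k))⁻¹) ^ 6
        = ∑ k ∈ (S i).filter (fun k => k ∈ sb), ((dist (y i) (y k))⁻¹) ^ 6
          + ∑ k ∈ (S i).filter (fun k => ¬ k ∈ sb), ((dist (y i) (y k))⁻¹) ^ 6 :=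
      (Finset.sum_filter_add_sum_filter_not (S i) (fun k => k ∈ sb) _).symm
    have h3 : ∑ k ∈ (S i).filter (fun k => ¬ k ∈ sb), ((dist (y i) (y k))⁻¹) ^ 6 ≤ 250 / ((19 / 20 : ℝ) ^ 3 * ρ₀ ^ 3) := by
      have hsubT : (S i).filter (fun k => ¬ k ∈ sb) ⊆ goodSet 12 ε₁ θ (19 / 20) y := fun k hk => by
        rw [Finset.mem_filter] at hk
        exact hlift (Finset.mem_sdiff.mpr ⟨hS i hi hk.1, hk.2⟩)
      have h := sum_invPowSix_le_of_separated (by norm_num : (0 : ℝ) < 19 / 20) hy (y i) hρ₀s hsubT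
        (fun k hk => by rw [dist_comm]; exact hfarρ i hi k (Finset.mem_filter.mp hk).1)
      calc ∑ k ∈ (S i).filter (fun k => ¬ k ∈ sb), ((dist (y i) (y k))⁻¹) ^ 6
          = ∑ k ∈ (S i).filter (fun k => ¬ k ∈ sb), ((dist (y k) (y i))⁻¹) ^ 6 :=
            Finset.sum_congr rfl fun k _ => by rw [dist_comm]
        _ ≤ 250 / ((19 / 20 : ℝ) ^ 3 * ρ₀ ^ 3) := h
    have h4 : ∑ k ∈ (S i).filter (fun k => k ∈ sb), ((dist (y i) (y k))⁻¹) ^ 6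
        = ∑ k ∈ sb, (if k ∈ S i then ((dist (y i) (y k))⁻¹) ^ 6 else 0) := by
      rw [← Finset.sum_filter]
      refine Finset.sum_congr ?_ fun k _ => rfl
      ext k; simp only [Finset.mem_filter]; tauto
    linarith [h1, h2, h3, h4]
  -- one scale-bad column: the rows of T facing it are a lifted good class beyond ρ₀
  have hcol : ∀ k ∈ sb, ∑ i ∈ T, (if k ∈ S i then ((dist (y i) (y k))⁻¹) ^ 6 else 0) ≤ 250 / ((19 / 20 : ℝ) ^ 3 * ρ₀ ^ 3) := by
    intro k _
    rw [← Finset.sum_filter]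
    have hsubT : T.filter (fun i => k ∈ S i) ⊆ goodSet 12 ε₁ θ (19 / 20) y := fun i hi => hlift (hT (Finset.mem_filter.mp hi).1)
    exact sum_invPowSix_le_of_separated (by norm_num : (0 : ℝ) < 19 / 20) hy (y k) hρ₀s hsubT
      (fun i hi => hfarρ i (Finset.mem_filter.mp hi).1 k (Finset.mem_filter.mp hi).2)
  -- sum up
  have hT0 : (0 : ℝ) ≤ (T.card : ℝ) := Nat.cast_nonneg _
  have hsb0 : (0 : ℝ) ≤ (sb.card : ℝ) := Nat.cast_nonneg _
  calc ∑ i ∈ T, -smoothTail (S i) y i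
      ≤ ∑ i ∈ T, (1 / 12 * (250 / ((19 / 20 : ℝ) ^ 3 * ρ₀ ^ 3))
          + 1 / 12 * ∑ k ∈ sb, (if k ∈ S i then ((dist (y i) (y k))⁻¹) ^ 6 else 0)) := Finset.sum_le_sum hrow
    _ = 1 / 12 * (250 / ((19 / 20 : ℝ) ^ 3 * ρ₀ ^ 3)) * (T.card : ℝ)
          + 1 / 12 * ∑ k ∈ sb, ∑ i ∈ T, (if k ∈ S i then ((dist (y i) (y k))⁻¹) ^ 6 else 0) := by
        rw [Finset.sum_add_distrib, Finset.sum_const, nsmul_eq_mul, ← Finset.mul_sum, Finset.sum_comm]; ring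
    _ ≤ 1 / 12 * (250 / ((19 / 20 : ℝ) ^ 3 * ρ₀ ^ 3)) * (T.card : ℝ)
          + 1 / 12 * ∑ k ∈ sb, (250 / ((19 / 20 : ℝ) ^ 3 * ρ₀ ^ 3)) :=
        add_le_add le_rfl (mul_le_mul_of_nonneg_left (Finset.sum_le_sum hcol) (by norm_num))
    _ = 1 / 12 * (250 / ((19 / 20 : ℝ) ^ 3 * ρ₀ ^ 3)) * ((T.card : ℝ) + (sb.card : ℝ)) := by
        rw [Finset.sum_const, nsmul_eq_mul]; ring
    _ ≤ 1 / 12 * (360 * (C₁ * ε₁)) * ((T.card : ℝ) + (sb.card : ℝ)) :=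
        mul_le_mul_of_nonneg_right (mul_le_mul_of_nonneg_left hL (by norm_num)) (by positivity)
    _ = 30 * C₁ * ε₁ * ((T.card : ℝ) + (sb.card : ℝ)) := by ring

/-! ## §3  The pieces with the scale-census allowance: Z3b⁗', Z3⁗' (TYPED), their position below the tree pieces, and the glue (PROVED) -/

/-- **Z3b⁗' · `RechartedInflowWallLawSb θ θ₀`** (v12′ · TYPED · WEAKER than Z3b⁗ `RechartedInflowWallLaw` · PROVED FROM NF in §4): R_aff ⇒
`∀ C ≥ 0 ∀ R ≥ 0 ∀ cL > 0 ∃ D, C''' ≥ 0, ε_W > 0 ∀ ε₁ ≤ ε_W ∀ δ ∈ (0,2] ∃ C_T ≥ 0 ∀ N y F` (admissible `Cε₁`-exact charts on `Sh_R`): there are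
RECHARTS `F'`, sub-classes `M i ⊆ G` and matchings `π i` (`Matched D ε₁`) with
`Σ_{i∈Sh_R} −smoothTail (G ∖ M i) y i ≤ C_T·#Gᶜ + C'''·ε₁·#Sh_R + cL·#sb` — the tree's Z3b⁗ plus an arbitrarily small charge per SCALE-BAD good site. -/
def RechartedInflowWallLawSb (θ θ₀ : ℝ) : Prop :=
  AffineChartStraightening → ∀ C : ℝ, 0 ≤ C → ∀ R : ℝ, 0 ≤ R → ∀ cL : ℝ, 0 < cL → ∃ D C''' εW : ℝ, 0 ≤ D ∧ 0 ≤ C''' ∧ 0 < εW ∧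
    ∀ ε₁ : ℝ, 0 < ε₁ → ε₁ ≤ εW → ∀ δ : ℝ, 0 < δ → δ ≤ 2 → ∃ CT : ℝ, 0 ≤ CT ∧
      ∀ (N : ℕ) (y : Fin N → EuclideanSpace ℝ (Fin 3)), Function.Injective y → ∀ F : Fin N → Chart,
        (∀ i ∈ shelteredFarSet R θ₀ 12 ε₁ θ δ y, IsChart C ε₁ y i (F i) ∧ ChartAdmissible θ (F i)) →
          ∃ (F' : Fin N → Chart) (M : Fin N → Finset (Fin N)) (π : Fin N → Fin N → EuclideanSpace ℝ (Fin 3)),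
            (∀ i ∈ shelteredFarSet R θ₀ 12 ε₁ θ δ y,
              Recharts θ (F i) (F' i) ∧ M i ⊆ goodSet 12 ε₁ θ δ y ∧ Matched D ε₁ y i (F' i) (M i) (π i)) ∧
            ∑ i ∈ shelteredFarSet R θ₀ 12 ε₁ θ δ y, -smoothTail (goodSet 12 ε₁ θ δ y \ M i) y i
              ≤ CT * (((goodSet 12 ε₁ θ δ y)ᶜ).card : ℝ) + C''' * ε₁ * ((shelteredFarSet R θ₀ 12 ε₁ θ δ y).card : ℝ)
                + cL * ((goodScaleBadSet 12 ε₁ θ δ y).card : ℝ)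

/-- **Z3⁗' · `RechartedTailTransferInfSb θ θ₀`** (v12′ · TYPED · WEAKER than Z3⁗ `RechartedTailTransferInf`): R_aff ⇒
`∀ C ≥ 0 ∀ R ≥ 0 ∀ cL > 0 ∃ C', ε_B ∀ ε₁ ≤ ε_B ∀ δ ∈ (0,2] ∃ C_T ≥ 0 ∀ N y F`:
`Σ_{i ∈ Sh_R} (rechartTailInf θ (F i) − smoothTail G y i) ≤ C_T·#Gᶜ + C'·ε₁·#Sh_R + cL·#sb`. -/
def RechartedTailTransferInfSb (θ θ₀ : ℝ) : Prop :=
  AffineChartStraightening →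
  ∀ C : ℝ, 0 ≤ C → ∀ R : ℝ, 0 ≤ R → ∀ cL : ℝ, 0 < cL → ∃ C' εB : ℝ, 0 ≤ C' ∧ 0 < εB ∧
    ∀ ε₁ : ℝ, 0 < ε₁ → ε₁ ≤ εB → ∀ δ : ℝ, 0 < δ → δ ≤ 2 →
    ∃ CT : ℝ, 0 ≤ CT ∧ ∀ (N : ℕ) (y : Fin N → EuclideanSpace ℝ (Fin 3)), Function.Injective y → ∀ F : Fin N → Chart,
      (∀ i ∈ shelteredFarSet R θ₀ 12 ε₁ θ δ y, IsChart C ε₁ y i (F i) ∧ ChartAdmissible θ (F i)) →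
        ∑ i ∈ shelteredFarSet R θ₀ 12 ε₁ θ δ y, (rechartTailInf θ (F i) - smoothTail (goodSet 12 ε₁ θ δ y) y i)
          ≤ CT * (((goodSet 12 ε₁ θ δ y)ᶜ).card : ℝ) + C' * ε₁ * ((shelteredFarSet R θ₀ 12 ε₁ θ δ y).card : ℝ)
            + cL * ((goodScaleBadSet 12 ε₁ θ δ y).card : ℝ)

/-- **Z3⁗' (selection form) · `RechartedTailTransferSelSb θ θ₀`**: a sitewise RECHART `F'` with `Σ (refTail (F' i) − smoothTail G y i) ≤ … + cL·#sb`
(the seam's input). -/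
def RechartedTailTransferSelSb (θ θ₀ : ℝ) : Prop :=
  AffineChartStraightening →
  ∀ C : ℝ, 0 ≤ C → ∀ R : ℝ, 0 ≤ R → ∀ cL : ℝ, 0 < cL → ∃ C' εB : ℝ, 0 ≤ C' ∧ 0 < εB ∧
    ∀ ε₁ : ℝ, 0 < ε₁ → ε₁ ≤ εB → ∀ δ : ℝ, 0 < δ → δ ≤ 2 →
    ∃ CT : ℝ, 0 ≤ CT ∧ ∀ (N : ℕ) (y : Fin N → EuclideanSpace ℝ (Fin 3)), Function.Injective y → ∀ F : Fin N → Chart,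
      (∀ i ∈ shelteredFarSet R θ₀ 12 ε₁ θ δ y, IsChart C ε₁ y i (F i) ∧ ChartAdmissible θ (F i)) →
        ∃ F' : Fin N → Chart,
          (∀ i ∈ shelteredFarSet R θ₀ 12 ε₁ θ δ y, Recharts θ (F i) (F' i)) ∧
          ∑ i ∈ shelteredFarSet R θ₀ 12 ε₁ θ δ y, (refTail (F' i) - smoothTail (goodSet 12 ε₁ θ δ y) y i)
            ≤ CT * (((goodSet 12 ε₁ θ δ y)ᶜ).card : ℝ) + C' * ε₁ * ((shelteredFarSet R θ₀ 12 ε₁ θ δ y).card : ℝ)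
              + cL * ((goodScaleBadSet 12 ε₁ θ δ y).card : ℝ)

/-- **Z3b⁗ ⇒ Z3b⁗'** (the allowance is nonnegative): the v12′ piece is WEAKER than the tree's. [this file] -/
theorem rechartedInflowWallLawSb_of_wallLaw {θ θ₀ : ℝ} (h : RechartedInflowWallLaw θ θ₀) : RechartedInflowWallLawSb θ θ₀ := by
  intro hR C hC R hR0 cL hcL
  obtain ⟨D, C''', εW, hD, hC''', hεW, hW⟩ := h hR C hC R hR0
  refine ⟨D, C''', εW, hD, hC''', hεW, fun ε₁ hε₁ hε₁W δ hδ hδ2 => ?_⟩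
  obtain ⟨CT, hCT, hW'⟩ := hW ε₁ hε₁ hε₁W δ hδ hδ2
  refine ⟨CT, hCT, fun N y hy F hF => ?_⟩
  obtain ⟨F', M, π, hsel, hsum⟩ := hW' N y hy F hF
  have h0 : 0 ≤ cL * ((goodScaleBadSet 12 ε₁ θ δ y).card : ℝ) := mul_nonneg hcL.le (Nat.cast_nonneg _)
  exact ⟨F', M, π, hsel, by linarith⟩

/-- **Z3⁗ ⇒ Z3⁗'** (the allowance is nonnegative). [this file] -/
theorem rechartedTailTransferInfSb_of_inf {θ θ₀ : ℝ} (h : RechartedTailTransferInf θ θ₀) : RechartedTailTransferInfSb θ θ₀ := by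
  intro hR C hC R hR0 cL hcL
  obtain ⟨C', εB, hC', hεB, hZ⟩ := h hR C hC R hR0
  refine ⟨C', εB, hC', hεB, fun ε₁ hε₁ hε₁B δ hδ hδ2 => ?_⟩
  obtain ⟨CT, hCT, hZ'⟩ := hZ ε₁ hε₁ hε₁B δ hδ hδ2
  refine ⟨CT, hCT, fun N y hy F hF => ?_⟩
  have h0 : 0 ≤ cL * ((goodScaleBadSet 12 ε₁ θ δ y).card : ℝ) := mul_nonneg hcL.le (Nat.cast_nonneg _)
  linarith [hZ' N y hy F hF]

/-- **Infimum form ⇒ selection form** (`C' ↦ C' + 1`, via `ε₁`-minimisers; verbatim the tree's `rechartedTailTransferSel_of_inf`). [this file] -/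
theorem rechartedTailTransferSelSb_of_inf {θ θ₀ : ℝ} (h : RechartedTailTransferInfSb θ θ₀) : RechartedTailTransferSelSb θ θ₀ := by
  intro hR C hC R hR0 cL hcL
  obtain ⟨C', εB, hC', hεB, hZ⟩ := h hR C hC R hR0 cL hcL
  refine ⟨C' + 1, εB, by linarith, hεB, fun ε₁ hε₁ hε₁B δ hδ hδ2 => ?_⟩
  obtain ⟨CT, hCT, hZ'⟩ := hZ ε₁ hε₁ hε₁B δ hδ hδ2
  refine ⟨CT, hCT, fun N y hy F hF => ?_⟩
  set G := goodSet 12 ε₁ θ δ y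
  set Sh := shelteredFarSet R θ₀ 12 ε₁ θ δ y
  have hch : ∀ i : Fin N, ∃ c' : Chart, i ∈ Sh → Recharts θ (F i) c' ∧ refTail c' < rechartTailInf θ (F i) + ε₁ := by
    intro i
    by_cases hi : i ∈ Sh
    · obtain ⟨c', hc', hlt⟩ := exists_recharts_lt (hF i hi).2 hε₁
      exact ⟨c', fun _ => ⟨hc', hlt⟩⟩
    · exact ⟨F i, fun h1 => absurd h1 hi⟩
  choose F' hF' using hch
  refine ⟨F', fun i hi => (hF' i hi).1, ?_⟩
  have hT := hZ' N y hy F hF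
  have hle : ∑ i ∈ Sh, (refTail (F' i) - smoothTail G y i) ≤ ∑ i ∈ Sh, ((rechartTailInf θ (F i) - smoothTail G y i) + ε₁) :=
    Finset.sum_le_sum fun i hi => by have h' := (hF' i hi).2; linarith
  rw [Finset.sum_add_distrib, Finset.sum_const, nsmul_eq_mul] at hle
  linarith

end Summit.AtomisticToContinuum.Crystallization.Theorems.OverbindingBudgetAffineFarSmoothSplit
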